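import Literature.MathematicalPhysics.KineticTheory.SecondQuantisedConjugateOperator
import Literature.MathematicalPhysics.KineticTheory.HarmonicChaosDecomposition
import HarnessLib

/-!
# The first-order (one-contraction) blocks of the anharmonic Liouvillian in the chaos picture

Topic `Literature/MathematicalPhysics/KineticTheory`; definition request `defn-AnharmonicPairBlock`
(wanted by crux `MourreDissolution`, stmt-AtomisticToContinuum-12594, line
`separable-vertex-faddeev-pair-sector` of route `EmbeddedDrudeMourre`: the line takes
`𝓛₁ = 𝓛₀ + λW₁`, `W₁` = the first-order pair block defined here, as its unperturbed tower and needs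
the kernels of `W₁` and their rank-`≤ 2` fibre structure to be citable). Companion of
`HarmonicChaosDecomposition.lean` (whose CONVENTIONS are used throughout) and of
`SecondQuantisedConjugateOperator.lean` (whose pointwise, measure-free style on real momentum
representatives `ShellPoint m n` is followed: every block is an explicit map
`(ShellPoint m n → ℂ) → (ShellPoint m' n' → ℂ)` on kernels, no Hilbert-space realisation).

## Setting and conventions (ALS06 §3; `HarmonicChaosDecomposition.lean`, module docstring)

The chain is `pinnedChain ω₂ lam β γ` (`FouriersLaw.lean`): `H = H₂ + H₄`,
`H₂ = Σ_x [p_x²/2 + ω₂ q_x²/2 + r_x²/2]`, `H₄ = Σ_x (lam q_x⁴ + β r_x⁴)/4`, `r_x = q_{x+1} − q_x`.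
Fourier `q̂(k) = Σ_x e^{−ikx} q_x`, `q_x = ∫ e^{ikx} q̂(k) dk` with `dk` the Haar PROBABILITY measure of
`𝕋 = ℝ/2πℤ` (ALS's `k ∈ [−½, ½]` is our `k/2π`); normal modes `a(k) = (ω q̂ + i p̂)/√(2ω)`
[ALS06 (3.5)], so `q̂(k) = n(k)(a(k) + ā(−k))`, `r̂(k) = (e^{ik} − 1) q̂(k)` with the NORMAL-MODE FACTOR
`n(k) = (2ω(k))^{−1/2}` (`modeFactor`), band `ω = PhononBoltzmann.dispersion ω₂`. Poisson brackets
`{a(k), ā(k')} = −iδ(k − k')`, `{a, a} = 0` (so that `ȧ = {a, H₂} = −iωa`, ALS06 (3.7)); the Liouvillian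
is `LA = {A, H}`, `U_t = e^{tL}`, and on the `(m,n)` chaos sector (kernels of `Π_{i<m} ā(k_i) Π_{j<n} a(k'_j)`)
`L₂` is multiplication by `iΩ_{m,n}`, `Ω_{m,n} = Σ ω(k_i) − Σ ω(k'_j)` (`shellFrequency`/`sectorPhase`).
Thermal state `μ₀` at temperature `T`: `E[ā(k)a(k')] = W(k)δ(k − k')`, `E[aa] = 0`,
`W = T/ω` [ALS06 (3.11)–(3.12); `thermalWeight`, here `thermalWeightR` on representatives].

THE QUARTIC ENERGY IN NORMAL MODES. With `φ(k) = a(k) + ā(−k)`,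
`H₄ = ¼ ∫_{q₁+q₂+q₃+q₄ = 0} V(q) Π_l n(q_l) φ(q_l) dq`, `V(q) = lam + β Π_l (e^{iq_l} − 1)`; on the
exact real constraint `Σ q_l = 0` the vertex is REAL, `V = lam + 16β Π_l sin(q_l/2)` (`modeVertex`,
`modeVertex_eq_exp_prod`; this is `PhononBoltzmann.vertex` in its variables, `vertex_eq_modeVertex`,
i.e. ALS's `λ` with Spohn's substitution rule for the bond quartic [Spohn06 §4 (4.9)–(4.11)]).
Hence `∂H₄/∂ā(k) = ∫_{Σq = k} V(−k, q₂, q₃, q₄) n(k) Π n(q_l) φ(q₂)φ(q₃)φ(q₄)` and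
`{a(k), H₄} = −i ∂H₄/∂ā(k)` — for `β = 0` literally ALS06 eq. (3.7),
`ȧ(k) = −iωa − iλ Σ_σ ∫ (16 ω ω₁ω₂ω₃)^{−1/2} δ(k + Σσ_j k_j) Π a(k_j, σ_j)` (`prod_modeFactor`:
`Π n = (16 Π ω)^{−1/2}`). SIGNED-MOMENTUM RULE: in a matrix element of `L₄ = {·, H₄}` the four arguments
of `V` are the momenta of the four legs meeting at the vertex, OLD legs (the leg of the monomial that
is differentiated away, and old legs contracted with vertex legs) with the sign of their charge
(`+k` for a creator `ā(k)`, `−k'` for an annihilator `a(k')`), NEW legs with the opposite sign; the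
constraint `Σ = 0` is momentum conservation, and on it `V = lam + 16β Π sin(·/2)` of the four momenta
(all sign patterns met below have an even number of minus signs).

WICK RE-EXPANSION (Janson 1997 Thm 3.15, eq. (3.10): a product of Wick products is the sum over
Feynman diagrams without intra-factor edges of the Wick values). `L₄` acting on a Wick monomial
`:X:` of degree `N = m + n` removes one leg (`∂/∂a` or `∂/∂ā`) and multiplies by the cubic
`φφφ`; re-expanding in Wick monomials gives terms with `c = 0, 1, 2, 3` contractions (edges), of
degree `N + 2 − 2c`, each contraction carrying one thermal weight `W` (edges `ā(k)—a(k)` of weight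
`W(k)δ`, `φ(q)—φ(q')` of weight `2W(q)δ(q + q')`). The blocks are therefore polynomial in `T`:
`c` contractions ⇒ homogeneous of degree `c` in `T` and of degree `1` in `(lam, β)`, so that
`block(T; lam, β) = T^{c−1}·block(1; Tlam, Tβ)` (`tKernel_temperature`, …) — the `(lamT, βT)`
homogeneity of the requesting crux.

## The first-order sector-preserving block `W₁` on `(m,n)` (request (ii)–(iii))

The ONE-contraction terms of `L₄ :X:` that stay in the sector `(m,n)` are (derivation by the two rules
above; recorded case by case in the docstrings):
* HARTREE (`pairBlockH`): the vertex leg contracts with another vertex leg (tadpole). Result: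
  multiplication by `i δΩ_H`, `δΩ_H(k; k') = Σ_i δω(k_i) − Σ_j δω(k'_j)` (`hartreePhase`) with the
  first-order THERMAL FREQUENCY SHIFT `δω(k) = 6 n(k)² ∫ W(q) n(q)² V(k, q, −q, −k) dq
  = (3T/2ω(k)) ∫ (lam + 16β sin²(k/2) sin²(q/2)) ω(q)⁻² dq` (`hartreeShift`, `hartreeShift_eq`; this is
  the effective quadratic Hamiltonian `q⁴/4 ↦ (3/2)⟨q²⟩q²`, `r⁴/4 ↦ (3/2)⟨r²⟩r²`). It VANISHES ON THE
  EXCHANGE DIAGONAL `k' = k ∘ σ` (`hartreePhase_exchange_diagonal`), in particular on `(1,1)`.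
* `T` (`pairBlockT`): a creator `ā(k_i)` is differentiated away and the vertex contracts with another
  creator `ā(k_{i'})`; the two remaining vertex legs are new creators `(p, p̃)`, `p + p̃ = k_i + k_{i'}`:
  the created PAIR is rescattered at fixed pair momentum `K`, all other legs spectators. Kernel (new pair
  `(p₁, p₂)` ← old pair `(x, K − x)`, `K = p₁ + p₂`, fibre variable `x ∈ 𝕋`):
  `tKernel(p₁, p₂, x) = 3 n(p₁)n(p₂) [W(x) + W(K−x)] n(x)n(K−x) V(x, K−x, −p₁, −p₂)`, and
  `(W_T F)(k; k') = i Σ_{i<i'} ⨍ tKernel(k_i, k_{i'}, x) F(k[i ↦ x, i' ↦ k_i + k_{i'} − x]; k') dx`.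
* `T′` (`pairBlockT'`): the same on the annihilated legs, with the opposite sign:
  `(W_{T′} F)(k; k') = −i Σ_{j<j'} ⨍ tKernel(k'_j, k'_{j'}, x) F(k; k'[j ↦ x, j' ↦ k'_j + k'_{j'} − x]) dx`.
* `X` (`pairBlockX`): the removed leg and the contracted leg have opposite charges (creator `k_i`,
  annihilator `k'_j`); they are replaced by a new (creator, annihilator) pair `(p, p')` with
  `p − p' = k_i − k'_j =: Q` (fibres of constant momentum TRANSFER). The two ways (remove the annihilator
  and contract the creator, weight `−W(k_i)`; remove the creator and contract the annihilator, weight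
  `+W(k'_j)`) combine into the kernel (new `(q; q')` ← old `(x; x − Q)`, `Q = q − q'`):
  `xKernel(q, q', x) = 6 n(q)n(q') [W(x − Q) − W(x)] n(x)n(x−Q) V(x, −(x−Q), −q, q')`, and
  `(W_X F)(k; k') = i Σ_{i,j} ⨍ xKernel(k_i, k'_j, x) F(k[i ↦ x]; k'[j ↦ x − (k_i − k'_j)]) dx`
  (it vanishes on `(1,1)`, where `Q = 0`).
`anharmonicPairBlock = W₁ = W_H + W_T + W_{T′} + W_X` (`1 + C(m,2) + C(n,2) + mn = C(m+n, 2)` pair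
fibrations: one rank-`≤ 2` fibre operator per pair of legs). Here `⨍ dx = (2π)⁻¹∫_{(−π,π]} dx`
(`zoneAvg`; `zoneAvg_comp_coe`: it is the integral against the Haar probability measure `μ𝕋` of
`HarmonicChaosDecomposition.lean` for periodic integrands). SEPARABILITY (request (iii), the ideator's
`VertexSeparableInFibre`): in each fibre the kernel is `u₁(out)v₁(in) + u₂(out)v₂(in)` because
`V = lam·1·1 + 16β·[sin sin](in)·[sin sin](out)` and the weights factorise over legs
(`vertexSeparableInFibre`, `tKernel_fibre`, `xKernel_fibre`, `tKernel_rank_le_two`,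
`xKernel_rank_le_two`). On `(2,2)` in the fibred coordinates `(K; p, p')` of the request (created pair
`(p, K − p)`, annihilated pair `(p', K − p')`, `fibrePoint`) the four blocks are evaluated in closed
form (`pairBlockH_fibrePoint`, `pairBlockT_fibrePoint`, `pairBlockT'_fibrePoint`,
`pairBlockX_fibrePoint`: `T` acts in `p` at fixed `(K, p')`, `T′` in `p'` at fixed `(K, p)`, and the
four `X` terms along the fibres `p − p'`, `p − (K − p')`, `(K − p) − p'`, `p' − p` = const).

## The metric correction at order `λ` (request (iv))

`L_λ = L₂ + λL₄` is skew for `⟨A, B⟩_λ = Σ_y Cov_{μ_λ}(A, B̄ ∘ τ_y)`, `μ_λ ∝ e^{−(H₂ + λH₄)/T}`, not for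
`⟨·,·⟩₀`. With `G₀(F, G) = m! n! ∫_{shell} F Ḡ Π W` (Janson Thm 3.9; the flat normalisation of
`HarmonicChaosDecomposition.kernelWeight`) and `d/dλ|₀ E_λ[Z] = −T⁻¹ Cov₀(Z, H₄)`, the first-order metric
is the third cumulant `M₁(X, Y) = −T⁻¹ κ₃(:X:, :Ȳ:, H₄)` = connected diagrams (Janson Thm 3.12 and
Remark 3.13): two vertex legs to `X`, two to `Ȳ`, the other legs of `X` matched with `Ȳ` — the SAME
`T/T′/X` channel structure with the pair weight `W(x)W(y)/T = T/(ω(x)ω(y))` (`pairWeight`) in place of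
`W(x) ± W(y)`, symmetric signs, plus the tadpole channel (the quadratic Wick part `∫ δω :āa: + …` of
`H₄`), a multiplication by `−Σ_{all legs} δω(k_l)/ω(k_l)`. As an operator relative to `G₀`
(`M₁(F, G) = G₀(metricCorrection F, G)`): `metricCorrection = metricH + metricT + metricT' + metricX`
with kernels `mtKernel = 3 n n · pairWeight · n n · V`, `mxKernel = 6 n n · pairWeight · n n · V`. The
PROVED identities `tKernel = (ω(x) + ω(K−x)) · mtKernel`, `xKernel = (ω(x) − ω(x−Q)) · mxKernel`
(`tKernel_eq_mul_mtKernel`, `xKernel_eq_mul_mxKernel`) are the kernel form of first-order skewness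
`G₀(W₁F, G) + G₀(F, W₁G) = −i[M₁(ΩF, G) − M₁(F, ΩG)]` (a cross-check of all coefficients).

## Sector-changing blocks (request (i))

The elementary amplitude of every block is `vertexAmplitude = V · Π n` at the signed momenta of the
four legs meeting at the vertex (rule above) times `∓i` (`−i` when an annihilator is differentiated
away, `+i` for a creator) times the product of the weights of the contracted legs, symmetrised over the
slots of the target sector. Two blocks are spelled out: PAIR CREATION `(m,n) → (m+1,n+1)` (zero
contractions, `pairCreation`; on `(1,1) → (2,2)` it is ALS's collision vertex with the collision bracket,
`(3i/2) Πn(p) Ṽ(p) [g(p'₁) + g(p'₂) − g(p₁) − g(p₂)]`, `pairCreation_one_one`; cross-check: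
`L₄H₂ = −L₂H₄` gives `−(3i/2)ΠnṼ·Ω₂₂`, the `(2,2)` component of `H₄` being `(3/2)∫ΠnṼ āāaa`) and
PAIR ANNIHILATION `(2,2) → (1,1)` (two contractions, `pairAnnihilation`, weights
`W₃W₄ − W₂W₃ − W₂W₄` / `W₁W₃ + W₂W₃ − W₁W₂` of ALS's loss/gain structure [ALS06 (3.16)]; cross-checked
against `pairCreation` and the `(2,2)×(1,1)` metric block by first-order skewness). Their composition
through the `(2,2)` resolvent is the second-order (Fermi-golden-rule / Boltzmann) operator on `(1,1)`.

## What is NOT here (and why)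

* No Hilbert-space realisation (boundedness on `L²(Shell m n)`, descent of the `Ioc`-integrals to the
  torus for periodic `F` — the kernels are `2π`-periodic in every variable, `tKernel_add_two_pi`, …),
  no T-matrix `(1 − λ g_K(z))⁻¹`, no Faddeev system: the sibling request `defn-SeparableTwoBodyTMatrix`.
* The remaining blocks of `L₄` — one-contraction blocks CHANGING the sector (`(m,n) → (m±1, n∓1)`,
  `(m±2, n∓2)`: Bogoliubov part of the Hartree Hamiltonian and charge-changing rescattering), the
  zero-contraction blocks other than pair creation (`(m,n) → (m+3,n−1), (m+2,n), (m,n+2), (m−1,n+3)`),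
  pair annihilation from `(m,n)` with `m + n > 4`, three-contraction blocks — are generated by the same
  two rules and are not spelled out; nor is the `O(λ²)` metric.
* Flat normalisation: all blocks act on PHYSICAL kernels `F` (coefficients of `:Πā Πa:`); on the
  flat-normalised kernels `Φ = √(m!n!) Π√W · F` of `HarmonicChaosDecomposition` they act by conjugation
  with that diagonal weight (e.g. `tKernel ↦ tKernel · √(W(p₁)W(p₂)/(W(x)W(K−x)))`), which changes no
  rank and no support.
* Off the zero-momentum shell / off the exact linear constraints the real vertex `lam + 16βΠ sin(·/2)`
  is a junk value (it is `4π`-, not `2π`-periodic in a single slot); every block evaluates `F` only at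
  configurations obtained from the input by momentum-conserving replacements, so shells go to shells
  (`fibrePoint_mem_zeroShell`).
* No source prints these kernels for the pinned FPU-`β` chain: they are the routine first-order Wick
  calculus of ALS06 §3/App. A (who note that the order-`λ` term of the two-point function is purely
  imaginary, cf. the factor `i` of `W₁`) with Spohn's vertex; every coefficient was derived twice (see the
  cross-checks named above) and the derivation is recorded in the docstrings. [folklore]

## References

* [ALS06] K. Aoki, J. Lukkarinen, H. Spohn, Energy transport in weakly anharmonic chains, J. Stat. Phys.
  124 (2006) 1105–1129, arXiv:cond-mat/0602082, §3 eqs. (3.3)–(3.12) (normal modes, the cubic force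
  (3.7) with `(16ωω₁ω₂ω₃)^{−1/2}`, covariance `W`), (3.16) (gain/loss weights), App. A (diagrams; the
  order-`λ` term is imaginary). [cite: AokiLukkarinenSpohn2006, eqs. (3.5)–(3.7), (3.11)–(3.12)]
* [Spohn06] H. Spohn, The phonon Boltzmann equation, properties and link to weakly anharmonic lattice
  dynamics, J. Stat. Phys. 124 (2006) 1041–1104, §4 (4.9)–(4.11) (vertex of difference potentials).
  [cite: Spohn2006Phonon, §4 eqs. (4.9)-(4.11)]
* [Jan97] S. Janson, Gaussian Hilbert Spaces (1997), Thm 3.9 (covariance of Wick products), Thm 3.12 and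
  Remark 3.13 (expectations / cumulants of products of Wick products = (connected) Feynman diagrams),
  Thm 3.15 eq. (3.10) (product of Wick products re-expanded in Wick products). [cite: Janson1997, Thms 3.9, 3.12, 3.15]
* J. Lukkarinen, Kinetic theory of phonons in weakly anharmonic particle chains, LNP 921 (2016), §2.1
  (on-site and FPU four-phonon kernels). [cite: Lukkarinen2016, §2.1]
* J. L. van Hemmen, Phys. Rep. 65 (1980) 43–149, §§3–4 (second-quantisation picture of the harmonic
  crystal; context only). [cite: vanHemmen1980, §§3–4]
-/

noncomputable section

open Finset MeasureTheory Set
open scoped BigOperators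

namespace Literature.MathematicalPhysics.KineticTheory.HarmonicChaos

open PhononBoltzmann (dispersion vertex dispersion_pos dispersion_neg dispersion_periodic)
open HeatConduction.PinnedChainKinetic (𝕋 μ𝕋)
open scoped HeatConduction.PinnedChainKinetic

variable {m n : ℕ}

/-! ## §1. Normal-mode data on real representatives; the Brillouin-zone average -/

/-- The **normal-mode factor** `n(k) = (2ω(k))^{−1/2}`: `q̂(k) = n(k)(a(k) + ā(−k))`, so every leg of
the quartic vertex carries one factor `n` (ALS06 (3.7): `Π_{l<4} n(k_l) = (16 ω ω₁ ω₂ ω₃)^{−1/2}`,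
`prod_modeFactor`). [cite: AokiLukkarinenSpohn2006, eqs. (3.5)–(3.7)] -/
def modeFactor (ω₂ k : ℝ) : ℝ :=
  (Real.sqrt (2 * dispersion ω₂ k))⁻¹

/-- `n(k) > 0` for `ω₂ > 0`. [folklore] -/
theorem modeFactor_pos {ω₂ : ℝ} (hω : 0 < ω₂) (k : ℝ) : 0 < modeFactor ω₂ k := by
  unfold modeFactor
  have := dispersion_pos hω k
  positivity

/-- `n(k)² = (2ω(k))⁻¹`. [folklore] -/
theorem modeFactor_sq {ω₂ : ℝ} (hω : 0 < ω₂) (k : ℝ) :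
    modeFactor ω₂ k ^ 2 = (2 * dispersion ω₂ k)⁻¹ := by
  unfold modeFactor
  rw [inv_pow, Real.sq_sqrt (by have := dispersion_pos hω k; positivity)]

/-- `n` is even. [folklore] -/
theorem modeFactor_neg (ω₂ k : ℝ) : modeFactor ω₂ (-k) = modeFactor ω₂ k := by
  simp [modeFactor, dispersion_neg]

/-- `n` is `2π`-periodic. [folklore] -/
theorem modeFactor_add_two_pi (ω₂ k : ℝ) : modeFactor ω₂ (k + 2 * Real.pi) = modeFactor ω₂ k := by
  simp [modeFactor, dispersion_periodic ω₂ k]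

/-- **ALS's vertex weight**: `n(k₀)n(k₁)n(k₂)n(k₃) = (16 ω(k₀)ω(k₁)ω(k₂)ω(k₃))^{−1/2}` (`ω₂ > 0`).
[cite: AokiLukkarinenSpohn2006, eq. (3.7)] -/
theorem prod_modeFactor {ω₂ : ℝ} (hω : 0 < ω₂) (k₀ k₁ k₂ k₃ : ℝ) :
    modeFactor ω₂ k₀ * modeFactor ω₂ k₁ * modeFactor ω₂ k₂ * modeFactor ω₂ k₃ =
      (Real.sqrt (16 * (dispersion ω₂ k₀ * dispersion ω₂ k₁ * dispersion ω₂ k₂ *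
        dispersion ω₂ k₃)))⁻¹ := by
  have h := fun k => (dispersion_pos hω k).le
  unfold modeFactor
  rw [← mul_inv, ← mul_inv, ← mul_inv, ← Real.sqrt_mul (by linarith [h k₀]),
    ← Real.sqrt_mul (by have := h k₀; have := h k₁; positivity),
    ← Real.sqrt_mul (by have := h k₀; have := h k₁; have := h k₂; positivity)]
  congr 2
  ring

/-- **The Rayleigh–Jeans weight on real representatives**, `W(k) = T/ω(k)` — the thermal two-point
function `E[ā(k)a(k')] = W(k)δ(k − k')` of `HarmonicChaosDecomposition.thermalWeight`, of which it is
the lift (`thermalWeight_coe`). Every Wick contraction of a block carries one factor `W`.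
[cite: AokiLukkarinenSpohn2006, eqs. (3.11)–(3.12)] -/
def thermalWeightR (ω₂ T k : ℝ) : ℝ :=
  T / dispersion ω₂ k

/-- `thermalWeight ω₂ T ↑k = thermalWeightR ω₂ T k` (same conventions as the chaos decomposition).
[folklore] -/
theorem thermalWeight_coe (ω₂ T k : ℝ) :
    HeatConduction.HarmonicChaos.thermalWeight ω₂ T (k : 𝕋) = thermalWeightR ω₂ T k := rfl

/-- `W` is even. [folklore] -/
theorem thermalWeightR_neg (ω₂ T k : ℝ) : thermalWeightR ω₂ T (-k) = thermalWeightR ω₂ T k := by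
  simp [thermalWeightR, dispersion_neg]

/-- `W` is `2π`-periodic. [folklore] -/
theorem thermalWeightR_add_two_pi (ω₂ T k : ℝ) :
    thermalWeightR ω₂ T (k + 2 * Real.pi) = thermalWeightR ω₂ T k := by
  simp [thermalWeightR, dispersion_periodic ω₂ k]

/-- `W` is linear in the temperature. [folklore] -/
theorem thermalWeightR_temperature (ω₂ T k : ℝ) :
    thermalWeightR ω₂ T k = T * thermalWeightR ω₂ 1 k := by
  unfold thermalWeightR; ring

/-- **The Brillouin-zone average** `⨍ f = (2π)⁻¹ ∫_{(−π, π]} f(x) dx` of a function of a real momentum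
representative — for `2π`-periodic `f` the integral against the Haar probability measure `dk` of `𝕋`
(`zoneAvg_comp_coe`), i.e. the measure in which `E[ā(k)a(k')] = W(k)δ(k − k')` and the momentum
`δ`'s of the blocks are written; Bochner integral, junk `0` when divergent. [folklore] -/
def zoneAvg {E : Type*} [NormedAddCommGroup E] [NormedSpace ℝ E] (f : ℝ → E) : E :=
  (2 * Real.pi)⁻¹ • ∫ x in Set.Ioc (-Real.pi) Real.pi, f x

/-- Unfolding the zone average. [folklore] -/
theorem zoneAvg_def {E : Type*} [NormedAddCommGroup E] [NormedSpace ℝ E] (f : ℝ → E) :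
    zoneAvg f = (2 * Real.pi)⁻¹ • ∫ x in Set.Ioc (-Real.pi) Real.pi, f x := rfl

/-- **The zone average of a periodic function is its Haar-probability integral over `𝕋`.**
[folklore] -/
theorem zoneAvg_comp_coe {E : Type*} [NormedAddCommGroup E] [NormedSpace ℝ E] (g : 𝕋 → E) :
    zoneAvg (fun x : ℝ => g (x : 𝕋)) = ∫ k, g k ∂μ𝕋 := by
  unfold zoneAvg
  have h := AddCircle.integral_preimage (2 * Real.pi) (-Real.pi) g
  have e : -Real.pi + 2 * Real.pi = Real.pi := by ring
  rw [e] at h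
  rw [h, AddCircle.volume_eq_smul_haarAddCircle, integral_smul_measure,
    ENNReal.toReal_ofReal Real.two_pi_pos.le, smul_smul,
    inv_mul_cancel₀ Real.two_pi_pos.ne', one_smul]

/-- The zone average of a constant. [folklore] -/
theorem zoneAvg_const {E : Type*} [NormedAddCommGroup E] [NormedSpace ℝ E] [CompleteSpace E]
    (c : E) : zoneAvg (fun _ : ℝ => c) = c := by
  unfold zoneAvg
  rw [setIntegral_const, measureReal_def, Real.volume_Ioc,
    ENNReal.toReal_ofReal (by linarith [Real.pi_pos]), smul_smul]
  have : (2 * Real.pi)⁻¹ * (Real.pi - -Real.pi) = 1 := by field_simp; ring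
  rw [this, one_smul]

/-- Constants come out of the zone average (complex integrands). [folklore] -/
theorem zoneAvg_const_mul (c : ℂ) (f : ℝ → ℂ) :
    zoneAvg (fun x => c * f x) = c * zoneAvg f := by
  unfold zoneAvg
  rw [integral_const_mul, Complex.real_smul, Complex.real_smul]
  ring

/-- Constants come out of the zone average (real integrands). [folklore] -/
theorem zoneAvg_const_mul_real (c : ℝ) (f : ℝ → ℝ) :
    zoneAvg (fun x => c * f x) = c * zoneAvg f := by
  unfold zoneAvg
  rw [integral_const_mul, smul_eq_mul, smul_eq_mul]
  ring

/-! ## §2. The quartic vertex in normal-mode variables -/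

/-- **The quartic vertex of `pinnedChain ω₂ lam β γ` in normal-mode variables** on the exact momentum
constraint `q₁ + q₂ + q₃ + q₄ = 0`: `V(q) = lam + β Π_l (e^{iq_l} − 1) = lam + 16β Π_l sin(q_l/2)`
(`modeVertex_eq_exp_prod`; real form), where `q_l` are the SIGNED momenta of the four legs meeting at
the vertex (module docstring: old legs with the sign of their charge, new legs with the opposite sign).
`PhononBoltzmann.vertex a b k₁ k₂ k₃ = modeVertex a b (−k₁) (−k₂) k₃ (k₁ + k₂ − k₃)`
(`vertex_eq_modeVertex`). Junk off the constraint (there `sin(q/2)` depends on the representative).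
[cite: Spohn2006Phonon, §4 eqs. (4.9)-(4.11)] -/
def modeVertex (lam β q₁ q₂ q₃ q₄ : ℝ) : ℝ :=
  lam + 16 * β * (Real.sin (q₁ / 2) * Real.sin (q₂ / 2) * Real.sin (q₃ / 2) * Real.sin (q₄ / 2))

/-- ALS's pair-collision vertex is the normal-mode vertex at the signed momenta
`(−k₁, −k₂, k₃, k₁ + k₂ − k₃)` (pair `(k₁, k₂)` in, pair `(k₃, k₄)` out). [folklore] -/
theorem vertex_eq_modeVertex (a b k₁ k₂ k₃ : ℝ) :
    vertex a b k₁ k₂ k₃ = modeVertex a b (-k₁) (-k₂) k₃ (k₁ + k₂ - k₃) := by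
  unfold vertex modeVertex
  simp only [neg_div, Real.sin_neg]
  ring

/-- **The normal-mode vertex IS `lam + β Π_l (e^{iq_l} − 1)` on the momentum constraint** (in
particular that product is real there). [cite: Spohn2006Phonon, §4 eqs. (4.9)-(4.11)] -/
theorem modeVertex_eq_exp_prod (lam β : ℝ) {q₁ q₂ q₃ q₄ : ℝ} (h : q₁ + q₂ + q₃ + q₄ = 0) :
    (modeVertex lam β q₁ q₂ q₃ q₄ : ℂ) =
      lam + β * ((Complex.exp (q₁ * Complex.I) - 1) * (Complex.exp (q₂ * Complex.I) - 1) *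
        (Complex.exp (q₃ * Complex.I) - 1) * (Complex.exp (q₄ * Complex.I) - 1)) := by
  have hq : q₄ = -q₁ + -q₂ - q₃ := by linarith
  have hv : modeVertex lam β q₁ q₂ q₃ q₄ = vertex lam β (-q₁) (-q₂) q₃ := by
    rw [vertex_eq_modeVertex, neg_neg, neg_neg, hq]
  rw [hv, PhononBoltzmann.vertex_eq_exp_prod lam β (-q₁) (-q₂) q₃, hq]
  push_cast
  ring_nf

/-- The vertex is even (four sign changes). [folklore] -/
theorem modeVertex_neg (lam β q₁ q₂ q₃ q₄ : ℝ) :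
    modeVertex lam β (-q₁) (-q₂) (-q₃) (-q₄) = modeVertex lam β q₁ q₂ q₃ q₄ := by
  unfold modeVertex
  simp only [neg_div, Real.sin_neg]
  ring

/-- Two sign changes do not change the vertex. [folklore] -/
theorem modeVertex_neg_neg (lam β q₁ q₂ q₃ q₄ : ℝ) :
    modeVertex lam β (-q₁) (-q₂) q₃ q₄ = modeVertex lam β q₁ q₂ q₃ q₄ := by
  unfold modeVertex
  simp only [neg_div, Real.sin_neg]
  ring

/-- The vertex is symmetric: transposition of the first two slots. [folklore] -/
theorem modeVertex_swap₁₂ (lam β q₁ q₂ q₃ q₄ : ℝ) :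
    modeVertex lam β q₂ q₁ q₃ q₄ = modeVertex lam β q₁ q₂ q₃ q₄ := by
  unfold modeVertex; ring

/-- The vertex is symmetric: cyclic shift. [folklore] -/
theorem modeVertex_cyclic (lam β q₁ q₂ q₃ q₄ : ℝ) :
    modeVertex lam β q₂ q₃ q₄ q₁ = modeVertex lam β q₁ q₂ q₃ q₄ := by
  unfold modeVertex; ring

/-- Shifting a representative consistently with the constraint (`q₁ ↦ q₁ + 2π`, `q₂ ↦ q₂ − 2π`) does not
change the vertex: it is a function on the constraint subgroup of `𝕋⁴`. [folklore] -/
theorem modeVertex_shift (lam β q₁ q₂ q₃ q₄ : ℝ) :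
    modeVertex lam β (q₁ + 2 * Real.pi) (q₂ - 2 * Real.pi) q₃ q₄ = modeVertex lam β q₁ q₂ q₃ q₄ := by
  unfold modeVertex
  have h1 : Real.sin ((q₁ + 2 * Real.pi) / 2) = -Real.sin (q₁ / 2) := by
    rw [show (q₁ + 2 * Real.pi) / 2 = q₁ / 2 + Real.pi by ring, Real.sin_add_pi]
  have h2 : Real.sin ((q₂ - 2 * Real.pi) / 2) = -Real.sin (q₂ / 2) := by
    rw [show (q₂ - 2 * Real.pi) / 2 = q₂ / 2 - Real.pi by ring, Real.sin_sub_pi]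
  rw [h1, h2]
  ring

/-- The same shift on the middle slots. [folklore] -/
theorem modeVertex_shift₂₃ (lam β q₁ q₂ q₃ q₄ : ℝ) :
    modeVertex lam β q₁ (q₂ + 2 * Real.pi) (q₃ - 2 * Real.pi) q₄ = modeVertex lam β q₁ q₂ q₃ q₄ := by
  rw [← modeVertex_cyclic lam β q₁ (q₂ + 2 * Real.pi), modeVertex_shift, modeVertex_cyclic]

/-- Homogeneity of the vertex in the couplings. [folklore] -/
theorem modeVertex_smul (ε lam β q₁ q₂ q₃ q₄ : ℝ) :
    modeVertex (ε * lam) (ε * β) q₁ q₂ q₃ q₄ = ε * modeVertex lam β q₁ q₂ q₃ q₄ := by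
  unfold modeVertex; ring

/-- **The elementary vertex amplitude** `V(q) Π_l n(q_l)` of the four legs meeting at a vertex (signed
momenta, module docstring): every matrix element of `L₄ = {·, H₄}` between Wick monomials is `∓i` times
this amplitude times the thermal weights of the contracted legs, symmetrised over the slots of the target
sector — `−i` when an annihilator is differentiated away (`{a(k), H₄} = −i ∂H₄/∂ā(k)`), `+i` for a
creator. For `β = 0` this is ALS's `λ (16 ω ω₁ ω₂ ω₃)^{−1/2}`. [cite: AokiLukkarinenSpohn2006, eq. (3.7)] -/
def vertexAmplitude (ω₂ lam β q₁ q₂ q₃ q₄ : ℝ) : ℝ :=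
  modeVertex lam β q₁ q₂ q₃ q₄ *
    (modeFactor ω₂ q₁ * modeFactor ω₂ q₂ * modeFactor ω₂ q₃ * modeFactor ω₂ q₄)

/-- Unfolding the vertex amplitude. [folklore] -/
theorem vertexAmplitude_def (ω₂ lam β q₁ q₂ q₃ q₄ : ℝ) :
    vertexAmplitude ω₂ lam β q₁ q₂ q₃ q₄ = modeVertex lam β q₁ q₂ q₃ q₄ *
      (modeFactor ω₂ q₁ * modeFactor ω₂ q₂ * modeFactor ω₂ q₃ * modeFactor ω₂ q₄) := rfl

/-! ## §3. The Hartree (tadpole) shift and the multiplier block `W_H` -/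

/-- **The first-order thermal (Hartree) frequency shift**
`δω(k) = 6 n(k)² ⨍ W(q) n(q)² V(k, q, −q, −k) dq = (3T/2ω(k)) ⨍ (lam + 16β sin²(k/2)sin²(q/2)) ω(q)⁻² dq`
(`hartreeShift_eq`): the contraction of two vertex legs with each other (`E[φ(q)φ(q')] = 2W(q)δ(q + q')`,
three pairings of the cubic `φφφ`) leaves the quadratic Wick part `∫ δω(k)(:ā(k)a(k): + ½:a(k)a(−k): +
½:ā(k)ā(−k):) dk` of `H₄`, i.e. the effective harmonic couplings `q⁴/4 ↦ (3/2)⟨q²⟩q²`, `r⁴/4 ↦ (3/2)⟨r²⟩r²`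
(`ω(k)² ↦ ω(k)² + 3 lam⟨q₀²⟩ + 3β⟨r₀²⟩·4sin²(k/2)`). [cite: Janson1997, Thm 3.15] -/
def hartreeShift (ω₂ T lam β k : ℝ) : ℝ :=
  6 * modeFactor ω₂ k ^ 2 *
    zoneAvg fun q => thermalWeightR ω₂ T q * modeFactor ω₂ q ^ 2 * modeVertex lam β k q (-q) (-k)

/-- **Closed form of the Hartree shift**: `δω(k) = (3T/(2ω(k))) ⨍ (lam + 16β sin²(k/2) sin²(q/2))/ω(q)² dq`
(`ω₂ > 0`). [folklore] -/
theorem hartreeShift_eq {ω₂ : ℝ} (hω : 0 < ω₂) (T lam β k : ℝ) :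
    hartreeShift ω₂ T lam β k = 3 * T / (2 * dispersion ω₂ k) *
      zoneAvg fun q => (lam + 16 * β * (Real.sin (k / 2) ^ 2 * Real.sin (q / 2) ^ 2)) /
        dispersion ω₂ q ^ 2 := by
  unfold hartreeShift
  have hk := dispersion_pos hω k
  have hint : (fun q => thermalWeightR ω₂ T q * modeFactor ω₂ q ^ 2 * modeVertex lam β k q (-q) (-k)) =
      fun q => T / 2 * ((lam + 16 * β * (Real.sin (k / 2) ^ 2 * Real.sin (q / 2) ^ 2)) /
        dispersion ω₂ q ^ 2) := by
    funext q
    have hq := dispersion_pos hω q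
    rw [modeFactor_sq hω, thermalWeightR, modeVertex]
    simp only [neg_div, Real.sin_neg]
    field_simp
  rw [hint, zoneAvg_const_mul_real, modeFactor_sq hω]
  field_simp
  ring

/-- `δω` is even. [folklore] -/
theorem hartreeShift_neg (ω₂ T lam β k : ℝ) :
    hartreeShift ω₂ T lam β (-k) = hartreeShift ω₂ T lam β k := by
  unfold hartreeShift
  rw [modeFactor_neg]
  congr 1
  congr 1
  funext q
  rw [neg_neg, ← modeVertex_neg lam β k q (-q) (-k), neg_neg, neg_neg]
  congr 1
  unfold modeVertex; ring

/-- `δω` is `2π`-periodic. [folklore] -/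
theorem hartreeShift_add_two_pi (ω₂ T lam β k : ℝ) :
    hartreeShift ω₂ T lam β (k + 2 * Real.pi) = hartreeShift ω₂ T lam β k := by
  unfold hartreeShift
  rw [modeFactor_add_two_pi]
  congr 1
  congr 1
  funext q
  rw [show -(k + 2 * Real.pi) = -k - 2 * Real.pi by ring]
  congr 1
  have := modeVertex_shift lam β k (-k) q (-q)
  -- reorder the slots: `V(k + 2π, q, −q, −k − 2π) = V(k, q, −q, −k)`
  unfold modeVertex at this ⊢
  have h1 : Real.sin ((k + 2 * Real.pi) / 2) = -Real.sin (k / 2) := by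
    rw [show (k + 2 * Real.pi) / 2 = k / 2 + Real.pi by ring, Real.sin_add_pi]
  have h2 : Real.sin ((-k - 2 * Real.pi) / 2) = -Real.sin (-k / 2) := by
    rw [show (-k - 2 * Real.pi) / 2 = -k / 2 - Real.pi by ring, Real.sin_sub_pi]
  rw [h1, h2]
  ring

/-- `δω` is linear in `T` and in `(lam, β)`: `δω(T; lam, β) = T·δω(1; lam, β)`. [folklore] -/
theorem hartreeShift_temperature (ω₂ T lam β k : ℝ) :
    hartreeShift ω₂ T lam β k = T * hartreeShift ω₂ 1 lam β k := by
  unfold hartreeShift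
  have : (fun q => thermalWeightR ω₂ T q * modeFactor ω₂ q ^ 2 * modeVertex lam β k q (-q) (-k)) =
      fun q => T * (thermalWeightR ω₂ 1 q * modeFactor ω₂ q ^ 2 * modeVertex lam β k q (-q) (-k)) := by
    funext q; rw [thermalWeightR_temperature]; ring
  rw [this, zoneAvg_const_mul_real]
  ring

/-- Homogeneity in the couplings: `δω(T; εlam, εβ) = ε δω(T; lam, β)`. [folklore] -/
theorem hartreeShift_smul (ω₂ T ε lam β k : ℝ) :
    hartreeShift ω₂ T (ε * lam) (ε * β) k = ε * hartreeShift ω₂ T lam β k := by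
  unfold hartreeShift
  have : (fun q => thermalWeightR ω₂ T q * modeFactor ω₂ q ^ 2 *
      modeVertex (ε * lam) (ε * β) k q (-q) (-k)) =
      fun q => ε * (thermalWeightR ω₂ T q * modeFactor ω₂ q ^ 2 * modeVertex lam β k q (-q) (-k)) := by
    funext q; rw [modeVertex_smul]; ring
  rw [this, zoneAvg_const_mul_real]
  ring

/-- **The Hartree multiplier** `δΩ_H(k; k') = Σ_i δω(k_i) − Σ_j δω(k'_j)` of the `(m,n)` sector (the
first-order shift of the free frequency `Ω_{m,n} = shellFrequency`). [folklore] -/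
def hartreePhase (ω₂ T lam β : ℝ) (p : ShellPoint m n) : ℝ :=
  (∑ i, hartreeShift ω₂ T lam β (p.1 i)) - ∑ j, hartreeShift ω₂ T lam β (p.2 j)

/-- **The Hartree block `W_H`** of the first-order Liouvillian on the `(m,n)` sector: multiplication by
`i δΩ_H` (the self-contraction of the vertex). [cite: Janson1997, Thm 3.15] -/
def pairBlockH (ω₂ T lam β : ℝ) (F : ShellPoint m n → ℂ) (p : ShellPoint m n) : ℂ :=
  Complex.I * (hartreePhase ω₂ T lam β p : ℂ) * F p

/-- Unfolding `W_H`. [folklore] -/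
theorem pairBlockH_apply (ω₂ T lam β : ℝ) (F : ShellPoint m n → ℂ) (p : ShellPoint m n) :
    pairBlockH ω₂ T lam β F p = Complex.I * (hartreePhase ω₂ T lam β p : ℂ) * F p := rfl

/-- **The Hartree multiplier vanishes on the exchange diagonal** `k' = k ∘ σ` of an `(m,m)` sector (the
created and annihilated momenta coincide up to relabelling): there the first-order shifts of the
created and annihilated frequencies cancel. [folklore] -/
theorem hartreePhase_exchange_diagonal (ω₂ T lam β : ℝ) (k : Fin m → ℝ) (σ : Equiv.Perm (Fin m)) :
    hartreePhase ω₂ T lam β ((k, k ∘ σ) : ShellPoint m m) = 0 := by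
  unfold hartreePhase
  simp only [Function.comp_apply]
  rw [Equiv.sum_comp σ (fun i => hartreeShift ω₂ T lam β (k i)), sub_self]

/-- `W_H = 0` on kernels evaluated on the exchange diagonal. [folklore] -/
theorem pairBlockH_exchange_diagonal (ω₂ T lam β : ℝ) (F : ShellPoint m m → ℂ) (k : Fin m → ℝ)
    (σ : Equiv.Perm (Fin m)) : pairBlockH ω₂ T lam β F (k, k ∘ σ) = 0 := by
  rw [pairBlockH_apply, hartreePhase_exchange_diagonal]
  simp

/-- On the `(1,1)` shell `k = k'` the Hartree multiplier vanishes identically: the one-phonon charges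
are not shifted at first order. [folklore] -/
theorem hartreePhase_one_one (ω₂ T lam β : ℝ) (p : ShellPoint 1 1) (h : p.1 0 = p.2 0) :
    hartreePhase ω₂ T lam β p = 0 := by
  simp [hartreePhase, h]

/-! ## §4. The pair-rescattering blocks `T`, `T′` and the transfer block `X` -/

/-- **The fibre kernel of the `T` block**: the amplitude for the created pair `(x, K − x)` to be
rescattered into `(p₁, p₂)`, `K = p₁ + p₂` (one creator differentiated away, the vertex contracted with
the other creator — weight `W` of the contracted leg, summed over the two orderings; the two remaining
vertex legs create the new pair):
`tKernel(p₁, p₂, x) = 3 · n(p₁)n(p₂) · [W(x) + W(K − x)] n(x)n(K − x) · V(x, K − x, −p₁, −p₂)`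
(`3` = number of ways to pick the contracted vertex leg). The same kernel serves `T′`. [cite: Janson1997, Thm 3.15] -/
def tKernel (ω₂ T lam β p₁ p₂ x : ℝ) : ℝ :=
  3 * (modeFactor ω₂ p₁ * modeFactor ω₂ p₂) *
    ((thermalWeightR ω₂ T x + thermalWeightR ω₂ T (p₁ + p₂ - x)) *
      (modeFactor ω₂ x * modeFactor ω₂ (p₁ + p₂ - x))) *
    modeVertex lam β x (p₁ + p₂ - x) (-p₁) (-p₂)

/-- Replacing the pair of momenta in the slots `i ≠ i'` by `(x, k_i + k_{i'} − x)` (pair momentum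
conserved). [folklore] -/
def replacePair (k : Fin m → ℝ) (i i' : Fin m) (x : ℝ) : Fin m → ℝ :=
  Function.update (Function.update k i x) i' (k i + k i' - x)

/-- **The `T` block** (created-pair rescattering) of the first-order Liouvillian on the `(m,n)` sector:
`(W_T F)(k; k') = i Σ_{i<i'} ⨍ tKernel(k_i, k_{i'}, x) F(k[i ↦ x, i' ↦ k_i + k_{i'} − x]; k') dx`.
[cite: Janson1997, Thm 3.15] -/
def pairBlockT (ω₂ T lam β : ℝ) (F : ShellPoint m n → ℂ) (p : ShellPoint m n) : ℂ :=
  Complex.I * ∑ i, ∑ i' ∈ Ioi i,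
    zoneAvg fun x => (tKernel ω₂ T lam β (p.1 i) (p.1 i') x : ℂ) * F (replacePair p.1 i i' x, p.2)

/-- **The `T′` block** (annihilated-pair rescattering): the same kernel on the primed legs with the
opposite sign (`{a, H₄} = −i∂H₄/∂ā` versus `{ā, H₄} = +i∂H₄/∂a`):
`(W_{T′} F)(k; k') = −i Σ_{j<j'} ⨍ tKernel(k'_j, k'_{j'}, x) F(k; k'[j ↦ x, j' ↦ k'_j + k'_{j'} − x]) dx`.
[cite: Janson1997, Thm 3.15] -/
def pairBlockT' (ω₂ T lam β : ℝ) (F : ShellPoint m n → ℂ) (p : ShellPoint m n) : ℂ :=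
  -(Complex.I * ∑ j, ∑ j' ∈ Ioi j,
    zoneAvg fun x => (tKernel ω₂ T lam β (p.2 j) (p.2 j') x : ℂ) * F (p.1, replacePair p.2 j j' x))

/-- **The fibre kernel of the `X` block**: the amplitude for the (creator, annihilator) pair
`(x; x − Q)` to be replaced by `(q; q')`, `Q = q − q'` the conserved momentum transfer; the two
contributions (annihilator differentiated away and creator `x` contracted, weight `−W(x)`; creator
differentiated away and annihilator `x − Q` contracted, weight `+W(x − Q)`) have the same vertex:
`xKernel(q, q', x) = 6 · n(q)n(q') · [W(x − Q) − W(x)] n(x)n(x − Q) · V(x, −(x − Q), −q, q')`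
(`6 = 3 · 2`: contracted vertex leg, and the assignment of the two remaining vertex legs to
creator/annihilator). [cite: Janson1997, Thm 3.15] -/
def xKernel (ω₂ T lam β q q' x : ℝ) : ℝ :=
  6 * (modeFactor ω₂ q * modeFactor ω₂ q') *
    ((thermalWeightR ω₂ T (x - (q - q')) - thermalWeightR ω₂ T x) *
      (modeFactor ω₂ x * modeFactor ω₂ (x - (q - q')))) *
    modeVertex lam β x (-(x - (q - q'))) (-q) q'

/-- **The `X` block** (creator–annihilator transfer) of the first-order Liouvillian on the `(m,n)` sector:
`(W_X F)(k; k') = i Σ_{i,j} ⨍ xKernel(k_i, k'_j, x) F(k[i ↦ x]; k'[j ↦ x − (k_i − k'_j)]) dx`.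
[cite: Janson1997, Thm 3.15] -/
def pairBlockX (ω₂ T lam β : ℝ) (F : ShellPoint m n → ℂ) (p : ShellPoint m n) : ℂ :=
  Complex.I * ∑ i, ∑ j,
    zoneAvg fun x => (xKernel ω₂ T lam β (p.1 i) (p.2 j) x : ℂ) *
      F (Function.update p.1 i x, Function.update p.2 j (x - (p.1 i - p.2 j)))

/-- **THE FIRST-ORDER ANHARMONIC PAIR BLOCK `W₁`** on the `(m,n)` chaos sector of the pinned chain at
temperature `T`: the sector-preserving one-contraction part of the Liouvillian perturbation
`L₄ = {·, H₄}` in the Wick basis, `W₁ = W_H + W_T + W_{T′} + W_X` — a Hartree multiplication plus one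
rank-`≤ 2` fibre integral operator per pair of legs (`C(m+n, 2)` pair fibrations). The resummed tower
of the requesting line is `𝓛₁ = iΩ_{m,n} + W₁` sector by sector. Linear in `T` and in `(lam, β)`.
[cite: AokiLukkarinenSpohn2006, eqs. (3.7), (3.11)–(3.12)] -/
def anharmonicPairBlock (ω₂ T lam β : ℝ) (F : ShellPoint m n → ℂ) (p : ShellPoint m n) : ℂ :=
  pairBlockH ω₂ T lam β F p + pairBlockT ω₂ T lam β F p + pairBlockT' ω₂ T lam β F p +
    pairBlockX ω₂ T lam β F p

/-- Unfolding `W₁`. [folklore] -/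
theorem anharmonicPairBlock_apply (ω₂ T lam β : ℝ) (F : ShellPoint m n → ℂ) (p : ShellPoint m n) :
    anharmonicPairBlock ω₂ T lam β F p =
      pairBlockH ω₂ T lam β F p + pairBlockT ω₂ T lam β F p + pairBlockT' ω₂ T lam β F p +
        pairBlockX ω₂ T lam β F p := rfl

/-! ### Elementary properties of the kernels -/

/-- `tKernel` is symmetric in the outgoing pair. [folklore] -/
theorem tKernel_swap (ω₂ T lam β p₁ p₂ x : ℝ) :
    tKernel ω₂ T lam β p₂ p₁ x = tKernel ω₂ T lam β p₁ p₂ x := by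
  unfold tKernel modeVertex
  rw [show p₂ + p₁ - x = p₁ + p₂ - x by ring]
  ring

/-- `tKernel` is symmetric under `x ↦ K − x` in the incoming pair. [folklore] -/
theorem tKernel_reflect (ω₂ T lam β p₁ p₂ x : ℝ) :
    tKernel ω₂ T lam β p₁ p₂ (p₁ + p₂ - x) = tKernel ω₂ T lam β p₁ p₂ x := by
  unfold tKernel modeVertex
  rw [show p₁ + p₂ - (p₁ + p₂ - x) = x by ring]
  ring

/-- `tKernel` is `2π`-periodic in the fibre variable. [folklore] -/
theorem tKernel_add_two_pi (ω₂ T lam β p₁ p₂ x : ℝ) :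
    tKernel ω₂ T lam β p₁ p₂ (x + 2 * Real.pi) = tKernel ω₂ T lam β p₁ p₂ x := by
  unfold tKernel
  rw [show p₁ + p₂ - (x + 2 * Real.pi) = p₁ + p₂ - x - 2 * Real.pi by ring, modeVertex_shift,
    thermalWeightR_add_two_pi, modeFactor_add_two_pi,
    show p₁ + p₂ - x - 2 * Real.pi = p₁ + p₂ - x + -1 * (2 * Real.pi) by ring]
  have hW := (Function.Periodic.int_mul (f := thermalWeightR ω₂ T)
    (fun k => thermalWeightR_add_two_pi ω₂ T k) (-1)) (p₁ + p₂ - x)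
  have hn := (Function.Periodic.int_mul (f := modeFactor ω₂)
    (fun k => modeFactor_add_two_pi ω₂ k) (-1)) (p₁ + p₂ - x)
  push_cast at hW hn
  rw [hW, hn]

/-- `tKernel` is `2π`-periodic in an outgoing momentum. [folklore] -/
theorem tKernel_add_two_pi_left (ω₂ T lam β p₁ p₂ x : ℝ) :
    tKernel ω₂ T lam β (p₁ + 2 * Real.pi) p₂ x = tKernel ω₂ T lam β p₁ p₂ x := by
  unfold tKernel
  rw [modeFactor_add_two_pi, show p₁ + 2 * Real.pi + p₂ - x = p₁ + p₂ - x + 2 * Real.pi by ring,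
    thermalWeightR_add_two_pi, modeFactor_add_two_pi,
    show -(p₁ + 2 * Real.pi) = -p₁ - 2 * Real.pi by ring]
  congr 1
  -- `V(x, K − x + 2π, −p₁ − 2π, −p₂) = V(x, K − x, −p₁, −p₂)`
  exact modeVertex_shift₂₃ lam β x (p₁ + p₂ - x) (-p₁) (-p₂)

/-- Linearity in the temperature: `tKernel(T) = T · tKernel(1)`. [folklore] -/
theorem tKernel_temperature (ω₂ T lam β p₁ p₂ x : ℝ) :
    tKernel ω₂ T lam β p₁ p₂ x = T * tKernel ω₂ 1 lam β p₁ p₂ x := by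
  unfold tKernel
  rw [thermalWeightR_temperature ω₂ T x, thermalWeightR_temperature ω₂ T (p₁ + p₂ - x)]
  ring

/-- Homogeneity in the couplings. [folklore] -/
theorem tKernel_smul (ω₂ T ε lam β p₁ p₂ x : ℝ) :
    tKernel ω₂ T (ε * lam) (ε * β) p₁ p₂ x = ε * tKernel ω₂ T lam β p₁ p₂ x := by
  unfold tKernel; rw [modeVertex_smul]; ring

/-- **The `(lamT, βT)` scaling**: the first-order kernel at temperature `T` and couplings `(lam, β)` is
the one at temperature `1` and couplings `(Tlam, Tβ)`. [folklore] -/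
theorem tKernel_scaling (ω₂ T lam β p₁ p₂ x : ℝ) :
    tKernel ω₂ T lam β p₁ p₂ x = tKernel ω₂ 1 (T * lam) (T * β) p₁ p₂ x := by
  rw [tKernel_smul, tKernel_temperature]

/-- `xKernel` vanishes at zero momentum transfer `q = q'` (the two contributions cancel): the `X` block
is zero on the `(1,1)` shell. [folklore] -/
theorem xKernel_self (ω₂ T lam β q x : ℝ) : xKernel ω₂ T lam β q q x = 0 := by
  simp [xKernel]

/-- `xKernel` is `2π`-periodic in the fibre variable. [folklore] -/
theorem xKernel_add_two_pi (ω₂ T lam β q q' x : ℝ) :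
    xKernel ω₂ T lam β q q' (x + 2 * Real.pi) = xKernel ω₂ T lam β q q' x := by
  unfold xKernel
  rw [show x + 2 * Real.pi - (q - q') = x - (q - q') + 2 * Real.pi by ring,
    thermalWeightR_add_two_pi, thermalWeightR_add_two_pi, modeFactor_add_two_pi,
    modeFactor_add_two_pi, show -(x - (q - q') + 2 * Real.pi) = -(x - (q - q')) - 2 * Real.pi by ring,
    modeVertex_shift]

/-- Linearity in the temperature. [folklore] -/
theorem xKernel_temperature (ω₂ T lam β q q' x : ℝ) :
    xKernel ω₂ T lam β q q' x = T * xKernel ω₂ 1 lam β q q' x := by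
  unfold xKernel
  rw [thermalWeightR_temperature ω₂ T x, thermalWeightR_temperature ω₂ T (x - (q - q'))]
  ring

/-- Homogeneity in the couplings. [folklore] -/
theorem xKernel_smul (ω₂ T ε lam β q q' x : ℝ) :
    xKernel ω₂ T (ε * lam) (ε * β) q q' x = ε * xKernel ω₂ T lam β q q' x := by
  unfold xKernel; rw [modeVertex_smul]; ring

/-- The `(lamT, βT)` scaling of the transfer kernel. [folklore] -/
theorem xKernel_scaling (ω₂ T lam β q q' x : ℝ) :
    xKernel ω₂ T lam β q q' x = xKernel ω₂ 1 (T * lam) (T * β) q q' x := by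
  rw [xKernel_smul, xKernel_temperature]

/-- The `X` block vanishes on the `(1,1)` shell `k = k'` (zero momentum transfer), so that together with
`hartreePhase_one_one` the whole first-order block annihilates the one-phonon charges: they move only
at second order (kinetic time scale). [folklore] -/
theorem pairBlockX_one_one (ω₂ T lam β : ℝ) (F : ShellPoint 1 1 → ℂ) (p : ShellPoint 1 1)
    (h : p.1 0 = p.2 0) : pairBlockX ω₂ T lam β F p = 0 := by
  unfold pairBlockX
  simp [h, xKernel_self, zoneAvg_const]

/-- `W₁ = 0` on the `(1,1)` shell (no pairs to rescatter, no Hartree shift, no transfer). [folklore] -/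
theorem anharmonicPairBlock_one_one (ω₂ T lam β : ℝ) (F : ShellPoint 1 1 → ℂ) (p : ShellPoint 1 1)
    (h : p.1 0 = p.2 0) : anharmonicPairBlock ω₂ T lam β F p = 0 := by
  rw [anharmonicPairBlock_apply, pairBlockX_one_one ω₂ T lam β F p h, pairBlockH_apply,
    hartreePhase_one_one ω₂ T lam β p h]
  have h1 : pairBlockT ω₂ T lam β F p = 0 := by
    unfold pairBlockT
    simp
  have h2 : pairBlockT' ω₂ T lam β F p = 0 := by
    unfold pairBlockT'
    simp
  rw [h1, h2]
  simp

/-! ## §5. Separability: every fibre kernel has rank at most two -/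

/-- **`VertexSeparableInFibre`** (the ideator's first lemma of the requesting line, over
`PhononBoltzmann.vertex`): at fixed pair momentum `K` ALS's vertex is a sum of TWO products of a
function of the incoming and a function of the outgoing relative momentum,
`Φ(p, K − p; p′, K − p′) = a·1·1 + [16b sin(p/2)sin((K−p)/2)]·[sin(p′/2)sin((K−p′)/2)]`. [folklore] -/
theorem vertexSeparableInFibre (a b K p p' : ℝ) :
    vertex a b p (K - p) p' =
      a * 1 + (16 * b * (Real.sin (p / 2) * Real.sin ((K - p) / 2))) *
        (Real.sin (p' / 2) * Real.sin ((K - p') / 2)) := by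
  unfold vertex
  rw [show p + (K - p) - p' = K - p' by ring]
  ring

/-- The outgoing factor `n(p)n(K − p)` of the `lam`-part of the `T` kernel in the fibre `K`. [folklore] -/
def tOut₁ (ω₂ K p : ℝ) : ℝ := modeFactor ω₂ p * modeFactor ω₂ (K - p)

/-- The outgoing factor `n(p)n(K − p) sin(p/2) sin((K − p)/2)` of the `β`-part. [folklore] -/
def tOut₂ (ω₂ K p : ℝ) : ℝ :=
  modeFactor ω₂ p * modeFactor ω₂ (K - p) * (Real.sin (p / 2) * Real.sin ((K - p) / 2))

/-- The incoming factor `3 lam [W(x) + W(K − x)] n(x)n(K − x)` of the `lam`-part. [folklore] -/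
def tIn₁ (ω₂ T lam K x : ℝ) : ℝ :=
  3 * lam * ((thermalWeightR ω₂ T x + thermalWeightR ω₂ T (K - x)) *
    (modeFactor ω₂ x * modeFactor ω₂ (K - x)))

/-- The incoming factor `3·16β [W(x) + W(K − x)] n(x)n(K − x) sin(x/2) sin((K − x)/2)` of the
`β`-part. [folklore] -/
def tIn₂ (ω₂ T β K x : ℝ) : ℝ :=
  3 * (16 * β) * ((thermalWeightR ω₂ T x + thermalWeightR ω₂ T (K - x)) *
    (modeFactor ω₂ x * modeFactor ω₂ (K - x)) * (Real.sin (x / 2) * Real.sin ((K - x) / 2)))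

/-- **The `T` kernel is separable of rank `≤ 2` in every pair-momentum fibre**:
`tKernel(p, K − p, x) = tOut₁(p)·tIn₁(x) + tOut₂(p)·tIn₂(x)`. [folklore] -/
theorem tKernel_fibre (ω₂ T lam β K p x : ℝ) :
    tKernel ω₂ T lam β p (K - p) x =
      tOut₁ ω₂ K p * tIn₁ ω₂ T lam K x + tOut₂ ω₂ K p * tIn₂ ω₂ T β K x := by
  unfold tKernel tOut₁ tOut₂ tIn₁ tIn₂ modeVertex
  rw [show p + (K - p) - x = K - x by ring]
  simp only [neg_div, Real.sin_neg]
  ring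

/-- **Rank `≤ 2` of the `T` (and `T′`) fibre operators**: for every pair momentum `K` there are
`u, v : Fin 2 → ℝ → ℝ` with `tKernel(p, K − p, x) = Σ_{r<2} u_r(p) v_r(x)`. [folklore] -/
theorem tKernel_rank_le_two (ω₂ T lam β K : ℝ) :
    ∃ u v : Fin 2 → ℝ → ℝ, ∀ p x, tKernel ω₂ T lam β p (K - p) x = ∑ r, u r p * v r x :=
  ⟨![tOut₁ ω₂ K, tOut₂ ω₂ K], ![tIn₁ ω₂ T lam K, tIn₂ ω₂ T β K], fun p x => by
    rw [tKernel_fibre, Fin.sum_univ_two]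
    rfl⟩

/-- The outgoing factor `n(q)n(q − Q)` of the `lam`-part of the `X` kernel in the fibre `Q`. [folklore] -/
def xOut₁ (ω₂ Q q : ℝ) : ℝ := modeFactor ω₂ q * modeFactor ω₂ (q - Q)

/-- The outgoing factor `n(q)n(q − Q) sin(q/2) sin((q − Q)/2)` of the `β`-part. [folklore] -/
def xOut₂ (ω₂ Q q : ℝ) : ℝ :=
  modeFactor ω₂ q * modeFactor ω₂ (q - Q) * (Real.sin (q / 2) * Real.sin ((q - Q) / 2))

/-- The incoming factor `6 lam [W(x − Q) − W(x)] n(x)n(x − Q)` of the `lam`-part. [folklore] -/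
def xIn₁ (ω₂ T lam Q x : ℝ) : ℝ :=
  6 * lam * ((thermalWeightR ω₂ T (x - Q) - thermalWeightR ω₂ T x) *
    (modeFactor ω₂ x * modeFactor ω₂ (x - Q)))

/-- The incoming factor `6·16β [W(x − Q) − W(x)] n(x)n(x − Q) sin(x/2) sin((x − Q)/2)` of the
`β`-part. [folklore] -/
def xIn₂ (ω₂ T β Q x : ℝ) : ℝ :=
  6 * (16 * β) * ((thermalWeightR ω₂ T (x - Q) - thermalWeightR ω₂ T x) *
    (modeFactor ω₂ x * modeFactor ω₂ (x - Q)) * (Real.sin (x / 2) * Real.sin ((x - Q) / 2)))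

/-- **The `X` kernel is separable of rank `≤ 2` in every momentum-transfer fibre**:
`xKernel(q, q − Q, x) = xOut₁(q)·xIn₁(x) + xOut₂(q)·xIn₂(x)`. [folklore] -/
theorem xKernel_fibre (ω₂ T lam β Q q x : ℝ) :
    xKernel ω₂ T lam β q (q - Q) x =
      xOut₁ ω₂ Q q * xIn₁ ω₂ T lam Q x + xOut₂ ω₂ Q q * xIn₂ ω₂ T β Q x := by
  unfold xKernel xOut₁ xOut₂ xIn₁ xIn₂ modeVertex
  rw [show q - (q - Q) = Q by ring]
  simp only [neg_div, Real.sin_neg, neg_sub]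
  rw [show (Q - x) / 2 = -((x - Q) / 2) by ring, Real.sin_neg]
  ring

/-- **Rank `≤ 2` of the `X` fibre operators**: for every momentum transfer `Q` there are
`u, v : Fin 2 → ℝ → ℝ` with `xKernel(q, q − Q, x) = Σ_{r<2} u_r(q) v_r(x)`. [folklore] -/
theorem xKernel_rank_le_two (ω₂ T lam β Q : ℝ) :
    ∃ u v : Fin 2 → ℝ → ℝ, ∀ q x, xKernel ω₂ T lam β q (q - Q) x = ∑ r, u r q * v r x :=
  ⟨![xOut₁ ω₂ Q, xOut₂ ω₂ Q], ![xIn₁ ω₂ T lam Q, xIn₂ ω₂ T β Q], fun q x => by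
    rw [xKernel_fibre, Fin.sum_univ_two]
    rfl⟩

/-! ## §6. The `(2,2)` sector in fibred coordinates `(K; p, p′)` -/

/-- **Fibred coordinates of the `(2,2)` shell**: created pair `(p, K − p)`, annihilated pair
`(p′, K − p′)`, `K` the conserved pair momentum. [folklore] -/
def fibrePoint (K p p' : ℝ) : ShellPoint 2 2 := (![p, K - p], ![p', K - p'])

/-- Components of a fibre point. [folklore] -/
@[simp] theorem fibrePoint_fst (K p p' : ℝ) : (fibrePoint K p p').1 = ![p, K - p] := rfl

/-- Components of a fibre point. [folklore] -/
@[simp] theorem fibrePoint_snd (K p p' : ℝ) : (fibrePoint K p p').2 = ![p', K - p'] := rfl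

/-- Fibre points lie on the zero-momentum shell. [folklore] -/
theorem fibrePoint_mem_zeroShell (K p p' : ℝ) : fibrePoint K p p' ∈ zeroShell 2 2 :=
  ⟨0, by simp [totalMomentum, fibrePoint, Fin.sum_univ_two]⟩

/-- Updating the first slot of a pair. [folklore] -/
theorem update_vec2_zero (a b x : ℝ) : Function.update ![a, b] 0 x = ![x, b] := by
  funext i; fin_cases i <;> simp

/-- Updating the second slot of a pair. [folklore] -/
theorem update_vec2_one (a b x : ℝ) : Function.update ![a, b] 1 x = ![a, x] := by
  funext i; fin_cases i <;> simp

/-- Replacing the pair of a two-slot configuration. [folklore] -/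
theorem replacePair_vec2 (a b x : ℝ) : replacePair ![a, b] 0 1 x = ![x, a + b - x] := by
  unfold replacePair
  rw [update_vec2_zero]
  funext i; fin_cases i <;> simp

/-- Sums over ordered pairs of `Fin 2` have one term. [folklore] -/
theorem sum_Ioi_fin_two (f : Fin 2 → Fin 2 → ℂ) : ∑ i, ∑ i' ∈ Ioi i, f i i' = f 0 1 := by
  rw [Fin.sum_univ_two, show Finset.Ioi (0 : Fin 2) = {1} from by decide,
    show Finset.Ioi (1 : Fin 2) = ∅ from by decide, Finset.sum_singleton, Finset.sum_empty, add_zero]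

/-- **`W_H` on `(2,2)` in fibred coordinates**: multiplication by
`i[δω(p) + δω(K − p) − δω(p′) − δω(K − p′)]`. [folklore] -/
theorem pairBlockH_fibrePoint (ω₂ T lam β : ℝ) (F : ShellPoint 2 2 → ℂ) (K p p' : ℝ) :
    pairBlockH ω₂ T lam β F (fibrePoint K p p') =
      Complex.I * ((hartreeShift ω₂ T lam β p + hartreeShift ω₂ T lam β (K - p) -
        hartreeShift ω₂ T lam β p' - hartreeShift ω₂ T lam β (K - p') : ℝ) : ℂ) *
        F (fibrePoint K p p') := by
  rw [pairBlockH_apply]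
  congr 3
  simp [hartreePhase, fibrePoint, Fin.sum_univ_two]
  ring

/-- **The Hartree multiplier vanishes on the exchange diagonal of `(2,2)`**, `p′ ≡ p` or
`p′ ≡ K − p (mod 2π)`. [folklore] -/
theorem hartreePhase_fibrePoint_exchange (ω₂ T lam β K p p' : ℝ)
    (h : (∃ ℓ : ℤ, p' = p + ℓ * (2 * Real.pi)) ∨ ∃ ℓ : ℤ, p' = K - p + ℓ * (2 * Real.pi)) :
    hartreePhase ω₂ T lam β (fibrePoint K p p') = 0 := by
  have hper : Function.Periodic (hartreeShift ω₂ T lam β) (2 * Real.pi) :=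
    fun k => hartreeShift_add_two_pi ω₂ T lam β k
  have e : hartreePhase ω₂ T lam β (fibrePoint K p p') =
      hartreeShift ω₂ T lam β p + hartreeShift ω₂ T lam β (K - p) -
        (hartreeShift ω₂ T lam β p' + hartreeShift ω₂ T lam β (K - p')) := by
    simp [hartreePhase, fibrePoint, Fin.sum_univ_two]
  rw [e]
  rcases h with ⟨ℓ, hℓ⟩ | ⟨ℓ, hℓ⟩
  · rw [hℓ, hper.int_mul ℓ p, show K - (p + ℓ * (2 * Real.pi)) = K - p + (-ℓ) * (2 * Real.pi) by ring]
    have := hper.int_mul (-ℓ) (K - p)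
    push_cast at this
    rw [this]; ring
  · rw [hℓ, hper.int_mul ℓ (K - p),
      show K - (K - p + ℓ * (2 * Real.pi)) = p + (-ℓ) * (2 * Real.pi) by ring]
    have := hper.int_mul (-ℓ) p
    push_cast at this
    rw [this]; ring

/-- **`W_T` on `(2,2)` in fibred coordinates** acts in `p` at fixed `(K, p′)`:
`(W_T F)(K; p, p′) = i ⨍ tKernel(p, K − p, x) F(K; x, p′) dx`. [folklore] -/
theorem pairBlockT_fibrePoint (ω₂ T lam β : ℝ) (F : ShellPoint 2 2 → ℂ) (K p p' : ℝ) :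
    pairBlockT ω₂ T lam β F (fibrePoint K p p') =
      Complex.I * zoneAvg fun x => (tKernel ω₂ T lam β p (K - p) x : ℂ) * F (fibrePoint K x p') := by
  unfold pairBlockT
  rw [sum_Ioi_fin_two]
  congr 1
  congr 1
  funext x
  simp only [fibrePoint_fst, fibrePoint_snd, Matrix.cons_val_zero, Matrix.cons_val_one,
    replacePair_vec2]
  rw [show p + (K - p) - x = K - x by ring]
  rfl

/-- **`W_{T′}` on `(2,2)` in fibred coordinates** acts in `p′` at fixed `(K, p)`:
`(W_{T′} F)(K; p, p′) = −i ⨍ tKernel(p′, K − p′, x) F(K; p, x) dx`. [folklore] -/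
theorem pairBlockT'_fibrePoint (ω₂ T lam β : ℝ) (F : ShellPoint 2 2 → ℂ) (K p p' : ℝ) :
    pairBlockT' ω₂ T lam β F (fibrePoint K p p') =
      -(Complex.I * zoneAvg fun x => (tKernel ω₂ T lam β p' (K - p') x : ℂ) *
        F (fibrePoint K p x)) := by
  unfold pairBlockT'
  rw [sum_Ioi_fin_two]
  congr 2
  congr 1
  funext x
  simp only [fibrePoint_fst, fibrePoint_snd, Matrix.cons_val_zero, Matrix.cons_val_one,
    replacePair_vec2]
  rw [show p' + (K - p') - x = K - x by ring]
  rfl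

/-- **`W_X` on `(2,2)` in fibred coordinates**: the four transfer terms, along the fibres
`p − p′`, `p − (K − p′)`, `(K − p) − p′`, `(K − p) − (K − p′)` = const (the new configuration again in
fibred coordinates, with the new pair momentum). [folklore] -/
theorem pairBlockX_fibrePoint (ω₂ T lam β : ℝ) (F : ShellPoint 2 2 → ℂ) (K p p' : ℝ) :
    pairBlockX ω₂ T lam β F (fibrePoint K p p') =
      Complex.I *
        ((zoneAvg fun x => (xKernel ω₂ T lam β p p' x : ℂ) *
            F (fibrePoint (K + x - p) x (x - (p - p')))) +
          (zoneAvg fun x => (xKernel ω₂ T lam β p (K - p') x : ℂ) *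
            F (fibrePoint (K + x - p) x p')) +
          ((zoneAvg fun x => (xKernel ω₂ T lam β (K - p) p' x : ℂ) *
            F (fibrePoint (p + x) p (x - (K - p - p')))) +
          (zoneAvg fun x => (xKernel ω₂ T lam β (K - p) (K - p') x : ℂ) *
            F (fibrePoint (p + x) p p')))) := by
  unfold pairBlockX
  simp only [Fin.sum_univ_two, fibrePoint_fst, fibrePoint_snd, Matrix.cons_val_zero,
    Matrix.cons_val_one, update_vec2_zero, update_vec2_one]
  congr 1
  have e : ∀ (a b c d : ℝ), (![a, b], ![c, d]) = fibrePoint (a + b) a c ↔ d = a + b - c := by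
    intro a b c d
    simp only [fibrePoint, Prod.mk.injEq, add_sub_cancel_left, true_and]
    constructor
    · intro h
      have := congrFun h 1
      simpa using this
    · intro h; rw [h]
  congr 1
  · congr 1
    · congr 1; funext x; congr 1
      rw [show K + x - p = x + (K - p) by ring]
      exact congrArg F ((e _ _ _ _).2 (by ring))
    · congr 1; funext x; congr 1
      rw [show K + x - p = x + (K - p) by ring]
      exact congrArg F ((e _ _ _ _).2 (by ring))
  · congr 1
    · congr 1; funext x; congr 1
      exact congrArg F ((e _ _ _ _).2 (by ring))
    · congr 1; funext x; congr 1
      exact congrArg F ((e _ _ _ _).2 (by ring))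

/-! ## §7. The metric correction at order `λ` -/

/-- **The pair weight** `W(x)W(y)/T = T/(ω(x)ω(y))` of a doubly contracted pair of legs per unit
temperature — the weight of the vertex-mediated channels of the first-order metric
`M₁ = −T⁻¹κ₃(·, ·, H₄)`. [folklore] -/
def pairWeight (ω₂ T x y : ℝ) : ℝ :=
  T / (dispersion ω₂ x * dispersion ω₂ y)

/-- `pairWeight = W(x)W(y)/T` for `T ≠ 0`. [folklore] -/
theorem pairWeight_eq {ω₂ T : ℝ} (hT : T ≠ 0) (x y : ℝ) :
    pairWeight ω₂ T x y = thermalWeightR ω₂ T x * thermalWeightR ω₂ T y / T := by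
  unfold pairWeight thermalWeightR
  field_simp

/-- **The fibre kernel of the metric `T`-channel**: `mtKernel(p₁, p₂, x) = 3 n(p₁)n(p₂) ·
pairWeight(x, K − x) n(x)n(K − x) · V(x, K − x, −p₁, −p₂)` (same vertex as `tKernel`, weight
`W(x)W(K − x)/T` in place of `W(x) + W(K − x)`). [cite: Janson1997, Thm 3.12] -/
def mtKernel (ω₂ T lam β p₁ p₂ x : ℝ) : ℝ :=
  3 * (modeFactor ω₂ p₁ * modeFactor ω₂ p₂) *
    (pairWeight ω₂ T x (p₁ + p₂ - x) * (modeFactor ω₂ x * modeFactor ω₂ (p₁ + p₂ - x))) *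
    modeVertex lam β x (p₁ + p₂ - x) (-p₁) (-p₂)

/-- **The fibre kernel of the metric `X`-channel**: `mxKernel(q, q′, x) = 6 n(q)n(q′) ·
pairWeight(x, x − Q) n(x)n(x − Q) · V(x, −(x − Q), −q, q′)`, `Q = q − q′`. [cite: Janson1997, Thm 3.12] -/
def mxKernel (ω₂ T lam β q q' x : ℝ) : ℝ :=
  6 * (modeFactor ω₂ q * modeFactor ω₂ q') *
    (pairWeight ω₂ T x (x - (q - q')) * (modeFactor ω₂ x * modeFactor ω₂ (x - (q - q')))) *
    modeVertex lam β x (-(x - (q - q'))) (-q) q'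

/-- **The tadpole channel of the metric**: multiplication by `−Σ_{all legs} δω(k_l)/ω(k_l)`
(`= −T⁻¹ Σ_l δω(k_l) W(k_l)`: one leg of `X` and the matching leg of `Y` contracted with the quadratic
Wick part `∫ δω :āa:` of `H₄`; all legs enter with the same sign, unlike `δΩ_H`). [cite: Janson1997, Remark 3.13] -/
def metricH (ω₂ T lam β : ℝ) (F : ShellPoint m n → ℂ) (p : ShellPoint m n) : ℂ :=
  -((((∑ i, hartreeShift ω₂ T lam β (p.1 i) / dispersion ω₂ (p.1 i)) +
      ∑ j, hartreeShift ω₂ T lam β (p.2 j) / dispersion ω₂ (p.2 j) : ℝ) : ℂ) * F p)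

/-- **The metric `T`-channel** (two created legs of `X` and two of `Y` to the vertex):
`(M_T F)(k; k') = −Σ_{i<i'} ⨍ mtKernel(k_i, k_{i'}, x) F(k[i ↦ x, i' ↦ k_i + k_{i'} − x]; k') dx`.
[cite: Janson1997, Remark 3.13] -/
def metricT (ω₂ T lam β : ℝ) (F : ShellPoint m n → ℂ) (p : ShellPoint m n) : ℂ :=
  -∑ i, ∑ i' ∈ Ioi i,
    zoneAvg fun x => (mtKernel ω₂ T lam β (p.1 i) (p.1 i') x : ℂ) * F (replacePair p.1 i i' x, p.2)

/-- **The metric `T′`-channel** (annihilated legs; same sign as `M_T` — the metric is symmetric).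
[cite: Janson1997, Remark 3.13] -/
def metricT' (ω₂ T lam β : ℝ) (F : ShellPoint m n → ℂ) (p : ShellPoint m n) : ℂ :=
  -∑ j, ∑ j' ∈ Ioi j,
    zoneAvg fun x => (mtKernel ω₂ T lam β (p.2 j) (p.2 j') x : ℂ) * F (p.1, replacePair p.2 j j' x)

/-- **The metric `X`-channel** (one created and one annihilated leg of each of `X`, `Y` to the vertex):
`(M_X F)(k; k') = −Σ_{i,j} ⨍ mxKernel(k_i, k'_j, x) F(k[i ↦ x]; k'[j ↦ x − (k_i − k'_j)]) dx`.
[cite: Janson1997, Remark 3.13] -/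
def metricX (ω₂ T lam β : ℝ) (F : ShellPoint m n → ℂ) (p : ShellPoint m n) : ℂ :=
  -∑ i, ∑ j,
    zoneAvg fun x => (mxKernel ω₂ T lam β (p.1 i) (p.2 j) x : ℂ) *
      F (Function.update p.1 i x, Function.update p.2 j (x - (p.1 i - p.2 j)))

/-- **THE FIRST-ORDER METRIC CORRECTION** on the `(m,n)` sector: the operator `M₁` with
`d/dλ|₀ ⟨X_F, X_G⟩_{μ_λ} = G₀(M₁ F, G)`, `G₀(F, G) = m! n! ∫_{shell} F Ḡ ΠW`, for the translation-summed
covariance form of `μ_λ ∝ e^{−(H₂ + λH₄)/T}` (`= −T⁻¹κ₃(:X_F:, :X̄_G:, H₄)`, the connected diagrams):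
`M₁ = M_H + M_T + M_{T′} + M_X`. With it `L₂ + λL₄` is skew to first order:
`G₀(W₁F, G) + G₀(F, W₁G) = −i[M₁(ΩF, G) − M₁(F, ΩG)]` (kernel form: `tKernel_eq_mul_mtKernel`,
`xKernel_eq_mul_mxKernel`). [cite: Janson1997, Thm 3.12 and Remark 3.13] -/
def metricCorrection (ω₂ T lam β : ℝ) (F : ShellPoint m n → ℂ) (p : ShellPoint m n) : ℂ :=
  metricH ω₂ T lam β F p + metricT ω₂ T lam β F p + metricT' ω₂ T lam β F p + metricX ω₂ T lam β F p

/-- Unfolding `M₁`. [folklore] -/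
theorem metricCorrection_apply (ω₂ T lam β : ℝ) (F : ShellPoint m n → ℂ) (p : ShellPoint m n) :
    metricCorrection ω₂ T lam β F p =
      metricH ω₂ T lam β F p + metricT ω₂ T lam β F p + metricT' ω₂ T lam β F p +
        metricX ω₂ T lam β F p := rfl

/-- **First-order skewness, `T`-channel**: `tKernel = (ω(x) + ω(K − x)) · mtKernel` — the
rescattering kernel is the metric kernel times the free frequency of the incoming pair, i.e.
`W(x) + W(K − x) = (ω(x) + ω(K − x)) · W(x)W(K − x)/T` (`ω₂ > 0`). [folklore] -/
theorem tKernel_eq_mul_mtKernel {ω₂ : ℝ} (hω : 0 < ω₂) (T lam β p₁ p₂ x : ℝ) :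
    tKernel ω₂ T lam β p₁ p₂ x =
      (dispersion ω₂ x + dispersion ω₂ (p₁ + p₂ - x)) * mtKernel ω₂ T lam β p₁ p₂ x := by
  unfold tKernel mtKernel pairWeight thermalWeightR
  have hx := (dispersion_pos hω x).ne'
  have hy := (dispersion_pos hω (p₁ + p₂ - x)).ne'
  field_simp
  ring

/-- **First-order skewness, `X`-channel**: `xKernel = (ω(x) − ω(x − Q)) · mxKernel`, i.e.
`W(x − Q) − W(x) = (ω(x) − ω(x − Q)) · W(x)W(x − Q)/T` (`ω₂ > 0`). [folklore] -/
theorem xKernel_eq_mul_mxKernel {ω₂ : ℝ} (hω : 0 < ω₂) (T lam β q q' x : ℝ) :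
    xKernel ω₂ T lam β q q' x =
      (dispersion ω₂ x - dispersion ω₂ (x - (q - q'))) * mxKernel ω₂ T lam β q q' x := by
  unfold xKernel mxKernel pairWeight thermalWeightR
  have hx := (dispersion_pos hω x).ne'
  have hy := (dispersion_pos hω (x - (q - q'))).ne'
  field_simp

/-- The metric `T`-kernel is separable of rank `≤ 2` in every fibre as well. [folklore] -/
theorem mtKernel_rank_le_two (ω₂ T lam β K : ℝ) :
    ∃ u v : Fin 2 → ℝ → ℝ, ∀ p x, mtKernel ω₂ T lam β p (K - p) x = ∑ r, u r p * v r x := by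
  refine ⟨![tOut₁ ω₂ K, tOut₂ ω₂ K],
    ![fun x => 3 * lam * (pairWeight ω₂ T x (K - x) * (modeFactor ω₂ x * modeFactor ω₂ (K - x))),
      fun x => 3 * (16 * β) * (pairWeight ω₂ T x (K - x) * (modeFactor ω₂ x * modeFactor ω₂ (K - x)) *
        (Real.sin (x / 2) * Real.sin ((K - x) / 2)))], fun p x => ?_⟩
  rw [Fin.sum_univ_two]
  simp only [Matrix.cons_val_zero, Matrix.cons_val_one]
  unfold mtKernel tOut₁ tOut₂ modeVertex
  rw [show p + (K - p) - x = K - x by ring]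
  simp only [neg_div, Real.sin_neg]
  ring

/-! ## §8. Pair creation `(m,n) → (m+1,n+1)` and pair annihilation `(2,2) → (1,1)` -/

/-- **The pair-creation block `(m,n) → (m+1,n+1)`** (zero contractions; the coupling of a sector to the
next pair sector, through which the second-order collision operator arises): on a symmetric kernel `F`
of `(m,n)`, at `(p; p′) ∈ ShellPoint (m+1) (n+1)`,
`(W₊F)(p; p′) = (6i/((m+1)(n+1))) · [ Σ_{i<i'} Σ_j A(p_i + p_{i'} − p′_j, −p_i, −p_{i'}, p′_j)
F(p ∖ {i,i'} ∪ {p_i + p_{i'} − p′_j}; p′ ∖ j) − Σ_i Σ_{j<j'} A(−(p′_j + p′_{j'} − p_i), −p_i, p′_j, p′_{j'})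
F(p ∖ i; p′ ∖ {j,j'} ∪ {p′_j + p′_{j'} − p_i}) ]`, `A = vertexAmplitude` (first sum: a creator of `F` is
differentiated away, `+i`, two new creators and one new annihilator; second: an annihilator, `−i`; the
factor `6/((m+1)(n+1))` = `3` vertex-leg choices × the symmetrisation over the slots of the target).
[cite: AokiLukkarinenSpohn2006, eq. (3.7)] -/
def pairCreation (ω₂ lam β : ℝ) (F : ShellPoint m n → ℂ) (p : ShellPoint (m + 1) (n + 1)) : ℂ :=
  (6 / ((m + 1 : ℕ) * (n + 1 : ℕ) : ℂ)) * Complex.I *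
    ((∑ i, ∑ i' ∈ Ioi i, ∑ j,
        (vertexAmplitude ω₂ lam β (p.1 i + p.1 i' - p.2 j) (-p.1 i) (-p.1 i') (p.2 j) : ℂ) *
          F (Fin.removeNth i' (Function.update p.1 i (p.1 i + p.1 i' - p.2 j)), Fin.removeNth j p.2)) -
      ∑ i, ∑ j, ∑ j' ∈ Ioi j,
        (vertexAmplitude ω₂ lam β (-(p.2 j + p.2 j' - p.1 i)) (-p.1 i) (p.2 j) (p.2 j') : ℂ) *
          F (Fin.removeNth i p.1, Fin.removeNth j' (Function.update p.2 j (p.2 j + p.2 j' - p.1 i))))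

/-- The diagonal profile `g(k) = F(k; k)` of a `(1,1)` kernel. [folklore] -/
def diagProfile (F : ShellPoint 1 1 → ℂ) (k : ℝ) : ℂ := F (fun _ => k, fun _ => k)

/-- **Pair creation from the one-phonon-charge sector**, `(1,1) → (2,2)`, on the shell
`p₁ + p₂ = p′₁ + p′₂`: ALS's collision vertex with the COLLISION BRACKET,
`(W₊F)(p₁, p₂; p′₁, p′₂) = (3i/2) · A(−p₁, −p₂, p′₁, p′₂) · [g(p′₁) + g(p′₂) − g(p₁) − g(p₂)]`,
`g = diagProfile F`, `A = Ṽ Πn` (cross-check: for `g = ω` this is `−(3i/2)ΠnṼ·Ω₂₂ = −L₂` of the `(2,2)`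
component `(3/2)∫ΠnṼ āāaa` of `H₄`, as `L₄H₂ = −L₂H₄` demands). [cite: AokiLukkarinenSpohn2006, eqs. (3.7), (3.16)] -/
theorem pairCreation_one_one (ω₂ lam β : ℝ) (F : ShellPoint 1 1 → ℂ) (p : ShellPoint 2 2)
    (hp : p.1 0 + p.1 1 = p.2 0 + p.2 1) :
    pairCreation ω₂ lam β F p =
      (3 / 2 : ℂ) * Complex.I * (vertexAmplitude ω₂ lam β (-p.1 0) (-p.1 1) (p.2 0) (p.2 1) : ℂ) *
        (diagProfile F (p.2 0) + diagProfile F (p.2 1) - diagProfile F (p.1 0) -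
          diagProfile F (p.1 1)) := by
  have r0 : p.1 0 + p.1 1 - p.2 0 = p.2 1 := by linarith
  have r1 : p.1 0 + p.1 1 - p.2 1 = p.2 0 := by linarith
  have s0 : p.2 0 + p.2 1 - p.1 0 = p.1 1 := by linarith
  have s1 : p.2 0 + p.2 1 - p.1 1 = p.1 0 := by linarith
  have rm0 : ∀ f : Fin 2 → ℝ, Fin.removeNth 0 f = fun _ => f 1 := fun f => by
    funext j; fin_cases j; simp [Fin.removeNth]
  have rm1 : ∀ f : Fin 2 → ℝ, Fin.removeNth 1 f = fun _ => f 0 := fun f => by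
    funext j; fin_cases j; simp [Fin.removeNth]
  unfold pairCreation
  rw [sum_Ioi_fin_two, Fin.sum_univ_two, Fin.sum_univ_two, sum_Ioi_fin_two, sum_Ioi_fin_two]
  simp only [r0, r1, s0, s1, rm0, rm1, Function.update_self, diagProfile]
  have e1 : (vertexAmplitude ω₂ lam β (p.2 1) (-p.1 0) (-p.1 1) (p.2 0) : ℂ) =
      vertexAmplitude ω₂ lam β (-p.1 0) (-p.1 1) (p.2 0) (p.2 1) := by
    rw [vertexAmplitude_def, vertexAmplitude_def]; unfold modeVertex; push_cast; ring
  have e2 : (vertexAmplitude ω₂ lam β (p.2 0) (-p.1 0) (-p.1 1) (p.2 1) : ℂ) =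
      vertexAmplitude ω₂ lam β (-p.1 0) (-p.1 1) (p.2 0) (p.2 1) := by
    rw [vertexAmplitude_def, vertexAmplitude_def]; unfold modeVertex; push_cast; ring
  have e3 : (vertexAmplitude ω₂ lam β (-p.1 1) (-p.1 0) (p.2 0) (p.2 1) : ℂ) =
      vertexAmplitude ω₂ lam β (-p.1 0) (-p.1 1) (p.2 0) (p.2 1) := by
    rw [vertexAmplitude_def, vertexAmplitude_def]; unfold modeVertex; push_cast; ring
  rw [e1, e2, e3]
  push_cast
  ring

/-- **The pair-annihilation block `(2,2) → (1,1)`** (two contractions; the partner of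
`pairCreation_one_one` in the second-order collision operator): the `(1,1)` profile
`(W₋F)(r) = 12 i n(r) · [ ⨍⨍ n(k₂)n(k₃)n(k₄) Ṽ (W₃W₄ − W₂W₃ − W₂W₄) F(r, k₂; k₃, k₄) dk₃dk₄
+ ⨍⨍ n(k₁)n(k₂)n(k₃) Ṽ (W₁W₃ + W₂W₃ − W₁W₂) F(k₁, k₂; k₃, r) dk₁dk₂ ]`, `k₂ = k₃ + k₄ − r` resp.
`k₃ = k₁ + k₂ − r` (the surviving leg `r` in a created resp. annihilated slot; `Ṽ` the real vertex of the
old configuration; ALS's loss/gain weights `W(−W₁W₂ − W₁W₃ + W₂W₃)`-type, here linearised: products of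
two weights = two contractions). Coefficients cross-checked against `pairCreation_one_one` and the
`(2,2) × (1,1)` metric block `−(6/T)∫FΠWΠnṼ Σ_l ḡ(k_l)W(k_l)` by first-order skewness.
[cite: AokiLukkarinenSpohn2006, eq. (3.16)] -/
def pairAnnihilation (ω₂ T lam β : ℝ) (F : ShellPoint 2 2 → ℂ) (r : ℝ) : ℂ :=
  12 * Complex.I * (modeFactor ω₂ r : ℂ) *
    ((zoneAvg fun k₃ => zoneAvg fun k₄ =>
        ((modeFactor ω₂ (k₃ + k₄ - r) * modeFactor ω₂ k₃ * modeFactor ω₂ k₄ *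
            modeVertex lam β r (k₃ + k₄ - r) (-k₃) (-k₄) *
            (thermalWeightR ω₂ T k₃ * thermalWeightR ω₂ T k₄ -
              thermalWeightR ω₂ T (k₃ + k₄ - r) * thermalWeightR ω₂ T k₃ -
              thermalWeightR ω₂ T (k₃ + k₄ - r) * thermalWeightR ω₂ T k₄) : ℝ) : ℂ) *
          F (![r, k₃ + k₄ - r], ![k₃, k₄])) +
      zoneAvg fun k₁ => zoneAvg fun k₂ =>
        ((modeFactor ω₂ k₁ * modeFactor ω₂ k₂ * modeFactor ω₂ (k₁ + k₂ - r) *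
            modeVertex lam β k₁ k₂ (-(k₁ + k₂ - r)) (-r) *
            (thermalWeightR ω₂ T k₁ * thermalWeightR ω₂ T (k₁ + k₂ - r) +
              thermalWeightR ω₂ T k₂ * thermalWeightR ω₂ T (k₁ + k₂ - r) -
              thermalWeightR ω₂ T k₁ * thermalWeightR ω₂ T k₂) : ℝ) : ℂ) *
          F (![k₁, k₂], ![k₁ + k₂ - r, r]))

end Literature.MathematicalPhysics.KineticTheory.HarmonicChaos
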